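import Summits.ResolutionOfSingularities.ResolutionOfSingularities.Theorems.EquisingularLiftEquisingularLiftNatStrictTransformComap
import Literature.AlgebraicGeometry.Resolution.IdealSheafClosedPoints
import Summits.ResolutionOfSingularities.ResolutionOfSingularities.Theorems.EquisingularLiftEquisingularLiftNatPreLetterPointStep
import Summits.ResolutionOfSingularities.ResolutionOfSingularities.Theorems.EquisingularLiftEquisingularLiftNatQuasiRegularPairCodimTwo
import Summits.ResolutionOfSingularities.ResolutionOfSingularities.Theorems.EquisingularLiftEquisingularLiftNatUncentredPairLemmas
import Literature.AlgebraicGeometry.Resolution.RegularLocalRingsProofs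
import HarnessLib

/-!
# [OURS · L1 W4.5(b) · EL♮(3) · WIDTH TABLE D5 «IMMATURE HOST» brick Δ2b] AN IMMATURE HYPERSURFACE (pre-letter) THROUGH A CURVE ROUND — F⁺5 ALONG A CURVE

Desk WIDTH TABLE D5 (2026-08-28), engine row D5-2 (res-L1-w45b-stub-4 g11), second half Δ2b = sub-clause (ii-T) of the joint clause proposal D5-0b v1.
`--supports stmt-ResolutionOfSingularities-20148`, no claim, counted 0.  AI-produced; NOT a statement of [Hironaka2017]; EL♮(3) is NOT proved here.

WHAT.
* ★ `comap_strictTransformIdeal_eq_of_curveModel` — res-type-027's F⁺5 ✓ `comap_strictTransformIdeal_eq_of_model` («the special fibre of the strict transform is the strict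
  transform of the special fibre») with the reduced closed POINT replaced by a closed SET `Z` of the special fibre (`υ = Bl_{𝓘⟨Z⟩}`, `J·𝒪_{F₁} = 𝓘⟨Z⟩`) and the cone pack
  supplied at every CLOSED point of `Z` (`F₂` Jacobson, `υ` proper: ideal sheaves are compared at closed points, Literature `ext_of_forall_closedPoint_stalkIdeal_eq`);
  the proof is 027's, point by point (res-type-100's stalk theorem `exists_stalk_strictTransformIdeal_sup_comap` is centre-generic).  The downstairs non-vanishing
  `Φ̄ ≢ 0 mod (c̄)` lives in the DOMAIN `𝒪_{F₁,z}/𝓘⟨Z⟩_z = 𝒪_{Z̃,z}`: GENERIC EQUIMULTIPLICITY along `Z`, tolerant of jump points (res-L1-w45b-idea-1 R17-2;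
  [Herrmann–Ikeda–Orbanz 1988, App. III (2.2.14)] for the notion; res-L1-w45b-stub-3's T-M1-EXACT ✓ p515745 is the ring form).
* ★ `preLetterClauses_strictTransform_of_curveRound` — the ENGINE spelling: centre `𝒞` regular with trace `𝓘⟨Z⟩` and 2-frames (✓ `hFrame_of_ringKrullDim_redSub`), `Z̃`
  regular, `G` regular of codimension 2 along `Z` at closed points; a hypersurface `𝓜` (principal, `O`-flat, `≠ ⊥`, off `Y`, trace `𝓘⟨M⟩`; NOT regular) with
  `𝓜_{j z} ≤ 𝒞_{j z}^a` and `(𝓜·𝒪_G)_z ⊄ 𝓘⟨Z⟩_z^{a+1}` at closed `z ∈ Z` keeps its four clauses through `Bl_𝒞` with trace `𝓘⟨closure (υ₂⁻¹(M ∖ Z))⟩`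
  (packs assembled by `Ideal.mem_span_pow_iff_exists_isHomogeneous`, `eval_mem_pow_succ_of_map_mk_eq_zero` (Δ2a file), `isQuasiRegular_of_span_pair_eq_stalkIdeal`,
  `isRegularLocalRing_quotient_stalkIdeal_of_isRegular_subscheme`, Literature `isDomain_of_isRegularLocalRing`).
-/

set_option linter.dupNamespace false

noncomputable section

universe u

open CategoryTheory CategoryTheory.Limits AlgebraicGeometry TopologicalSpace Topology IsLocalRing
open Literature.AlgebraicGeometry.Resolution
open AlgebraicGeometry.Scheme.IdealSheafData

namespace Summit.ResolutionOfSingularities.ResolutionOfSingularities.Cruxes.EquisingularLiftNat.Sections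

set_option maxHeartbeats 1600000 in -- as F⁺5 (two instances of the chart-algebra stalk theorem plus stalk transport)
/-- **F⁺5 ALONG A CURVE — «the special fibre of the strict transform is the strict transform of the special fibre» for a CURVE centre.**
res-type-027's ✓ `comap_strictTransformIdeal_eq_of_model` VERBATIM with the reduced closed point `x` replaced by a closed set `Z` of the special fibre
(`υ = Bl_{𝓘⟨Z⟩}`, `J·𝒪_{F₁} = 𝓘⟨Z⟩`) and the cone pack supplied at EVERY point `z ∈ Z` that is CLOSED (`F₂` Jacobson, `υ` proper — equality of ideal sheaves is checked at closed points; frame `c` of `J_{j z}` with domain quotient, the equation of `K` a FORM `Φ`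
of degree `d` in the frame, `Φ ≢ 0 mod (c)` upstairs and `Φ̄ ≢ 0 mod (c̄)` downstairs in the DOMAIN `𝒪_{F₁,z}/𝓘⟨Z⟩_z` — GENERIC EQUIMULTIPLICITY along `Z`, tolerant of
jump points); the proof is 027's, point by point over `Z` (res-type-100's stalk theorem `exists_stalk_strictTransformIdeal_sup_comap` is centre-generic).
[cite: StacksProject, Tag 0804] [cite: GortzWedhorn2020, (13.19)] [OURS · L1 W4.5b · WIDTH TABLE D5 brick Δ2b core] -/
theorem comap_strictTransformIdeal_eq_of_curveModel {X' X₁ F₁ F₂ : Scheme.{0}} (τ : X₁ ⟶ X')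
    (J K : X'.IdealSheafData) (hτ : IsBlowup τ J) [IsLocallyNoetherian X₁] [IsLocallyNoetherian F₂] [JacobsonSpace F₂]
    [IsIntegral F₁] [IsIntegral F₂] [IsLocallyNoetherian F₁]
    (j : F₁ ⟶ X') (υ : F₂ ⟶ F₁) (j₂ : F₂ ⟶ X₁) (hcomm : j₂ ≫ τ = υ ≫ j)
    (Z : Set F₁) (hZ : IsClosed Z)
    (hυ : IsBlowup υ (vanishingIdeal ⟨Z, hZ⟩)) (hJ : J.comap j = vanishingIdeal ⟨Z, hZ⟩)
    -- the cone data at EVERY point of the special fibre of the centre, with its image downstairs (generic equimultiplicity along `Z`)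
    (hpack : ∀ z ∈ Z, IsClosed ({z} : Set F₁) → ∃ (r : ℕ) (c : Fin r → X'.presheaf.stalk (j z)) (d : ℕ) (Φ : MvPolynomial (Fin r) (X'.presheaf.stalk (j z))),
      Ideal.span (Set.range c) = stalkIdeal J (j z) ∧ IsQuasiRegular c ∧ IsDomain (X'.presheaf.stalk (j z) ⧸ Ideal.span (Set.range c)) ∧
      Φ.IsHomogeneous d ∧ MvPolynomial.map (Ideal.Quotient.mk (Ideal.span (Set.range c))) Φ ≠ 0 ∧
      stalkIdeal K (j z) = Ideal.span {MvPolynomial.eval c Φ} ∧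
      IsQuasiRegular (fun i => (j.stalkMap z).hom (c i)) ∧
      IsDomain (F₁.presheaf.stalk z ⧸ stalkIdeal (vanishingIdeal ⟨Z, hZ⟩ : F₁.IdealSheafData) z) ∧
      MvPolynomial.map (Ideal.Quotient.mk (Ideal.span (Set.range fun i => (j.stalkMap z).hom (c i))))
        (MvPolynomial.map (j.stalkMap z).hom Φ) ≠ 0) :
    (strictTransformIdeal τ J K).comap j₂ = strictTransformIdeal υ (vanishingIdeal ⟨Z, hZ⟩) (K.comap j) := by
  classical
  -- adapted from `comap_strictTransformIdeal_sup_comap_eq_of_model` (…NatCarrierDeltaComap, res-D-pv-029)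
  -- the carrier identity `(J · 𝒪_{X₁}) · 𝒪_{F₂} = 𝔪_x · 𝒪_{F₂}`
  have hE : (J.comap τ).comap j₂ = (vanishingIdeal ⟨Z, hZ⟩ : F₁.IdealSheafData).comap υ := by
    rw [← hJ, ← Scheme.IdealSheafData.comap_comp, ← Scheme.IdealSheafData.comap_comp, hcomm]
  haveI : IsProper υ := hυ.isProper
  refine ext_of_forall_closedPoint_stalkIdeal_eq fun y hycl => ?_
  have hυycl : IsClosed ({υ y} : Set F₁) := by
    have h := υ.isClosedMap _ (mem_closedPoints_iff.mp hycl)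
    rwa [Set.image_singleton] at h
  by_cases hy : υ y ∈ Z
  · obtain ⟨r, c, d, Φ, hcJ, hc, hdomU, hΦd, hΦ, hK, hcbar, hdomD, hΦbar⟩ := hpack (υ y) hy hυycl
    haveI := hdomU
    have hτx' : τ (j₂ y) = j (υ y) := by
      rw [← Scheme.Hom.comp_apply, hcomm, Scheme.Hom.comp_apply]
    have hxJ : j (υ y) ∈ (J.support : Set X') := by
      have : υ y ∈ ((J.comap j).support : Set F₁) := by
        rw [hJ, Scheme.IdealSheafData.coe_support_vanishingIdeal]; exact hy
      rw [Scheme.IdealSheafData.support_comap] at this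
      exact this
    -- the downstairs cone data
    set cb : Fin r → F₁.presheaf.stalk (υ y) := fun i => (j.stalkMap (υ y)).hom (c i) with hcb
    set Φb : MvPolynomial (Fin r) (F₁.presheaf.stalk (υ y)) := MvPolynomial.map (j.stalkMap (υ y)).hom Φ with hΦb
    have hrange : Set.range cb = (j.stalkMap (υ y)).hom '' Set.range c := by
      rw [hcb]; exact Set.range_comp _ _
    have hcbJ : Ideal.span (Set.range cb) = stalkIdeal (vanishingIdeal ⟨Z, hZ⟩ : F₁.IdealSheafData) (υ y) := by
      rw [← hJ, stalkIdeal_comap_eq_map_stalkMap, ← hcJ, Ideal.map_span, hrange]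
    haveI hdomcb : IsDomain (F₁.presheaf.stalk (υ y) ⧸ Ideal.span (Set.range cb)) := by rw [hcbJ]; exact hdomD
    have hcbtop : Ideal.span (Set.range cb) ≠ ⊤ := by
      intro h
      have : Subsingleton (F₁.presheaf.stalk (υ y) ⧸ Ideal.span (Set.range cb)) := Ideal.Quotient.subsingleton_iff.mpr h
      exact false_of_nontrivial_of_subsingleton (F₁.presheaf.stalk (υ y) ⧸ Ideal.span (Set.range cb))
    have hΦbd : Φb.IsHomogeneous d := hΦd.map _
    have hevalb : (j.stalkMap (υ y)).hom (MvPolynomial.eval c Φ) = MvPolynomial.eval cb Φb := by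
      rw [hΦb, MvPolynomial.eval_map, show MvPolynomial.eval c Φ = MvPolynomial.eval₂ (RingHom.id _) c Φ from rfl,
        MvPolynomial.eval₂_comp_left, RingHom.comp_id]
      rfl
    have hKb : stalkIdeal (K.comap j) (υ y) = Ideal.span {MvPolynomial.eval cb Φb} := by
      rw [stalkIdeal_comap_eq_map_stalkMap, hK, Ideal.map_span, Set.image_singleton, hevalb]
    have hyJ : υ y ∈ ((vanishingIdeal ⟨Z, hZ⟩ : F₁.IdealSheafData).support : Set F₁) := by
      rw [Scheme.IdealSheafData.coe_support_vanishingIdeal]; exact hy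
    -- the two stalk presentations (strict-transform conjuncts)
    obtain ⟨jj, χ, hχ, hEu, hStu⟩ :=
      exists_stalk_strictTransformIdeal_of_eq hτ K (j₂ y) (j (υ y)) hτx' hxJ c hcJ hc Φ hΦd hΦ hK
    obtain ⟨j', 𝔔', χ', e', hχ', -, -, hEd, hStd, -, -⟩ :=
      exists_stalk_strictTransformIdeal_sup_comap hυ (K.comap j) y hyJ cb hcbJ hcbar Φb hΦbd hΦbar hKb
    -- everything in `A = 𝒪_{F₂,y}`
    set ψ : blowupAlgebra (Ideal.span (Set.range c)) (c jj) →+* F₂.presheaf.stalk y := (j₂.stalkMap y).hom.comp χ with hψ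
    set t : F₂.presheaf.stalk y := ψ (algebraMap _ _ (c jj)) with ht
    set t' : F₂.presheaf.stalk y := χ' (algebraMap _ _ (cb j')) with ht'
    set q : Fin r → F₂.presheaf.stalk y := fun l => ψ (blowupAlgebra.frac c jj l) with hq
    set q' : Fin r → F₂.presheaf.stalk y := fun l => χ' (blowupAlgebra.frac cb j' l) with hq'
    -- the coefficient maps agree: `ψ ∘ alg = υ^♯ ∘ j^♯ = χ' ∘ alg ∘ j^♯`
    have hcoef : ∀ a : X'.presheaf.stalk (j (υ y)),
        ψ (algebraMap _ _ a) = (υ.stalkMap y).hom ((j.stalkMap (υ y)).hom a) := by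
      intro a
      rw [hψ, RingHom.comp_apply, hχ]
      have h1 : (j₂ ≫ τ).stalkMap y = (X'.presheaf.stalkCongr (.of_eq (by rw [hcomm]))).hom ≫ (υ ≫ j).stalkMap y :=
        Scheme.Hom.stalkMap_congr_hom _ _ hcomm y
      have h2 : ∀ z, (j₂.stalkMap y).hom ((τ.stalkMap (j₂ y)).hom z) = ((j₂ ≫ τ).stalkMap y).hom z := fun z => by
        rw [Scheme.Hom.stalkMap_comp]; rfl
      have h3 : ((X'.presheaf.stalkCongr (.of_eq (by rw [hcomm]) : Inseparable ((j₂ ≫ τ) y) ((υ ≫ j) y))).hom)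
          ((X'.presheaf.stalkCongr (Inseparable.of_eq hτx')).inv a) = a := by
        change ((X'.presheaf.stalkCongr (Inseparable.of_eq hτx')).inv ≫
          (X'.presheaf.stalkCongr (Inseparable.of_eq hτx')).hom) a = a
        rw [Iso.inv_hom_id]; rfl
      have h4 : ∀ b, ((υ ≫ j).stalkMap y).hom b = (υ.stalkMap y).hom ((j.stalkMap (υ y)).hom b) := fun b => by
        rw [Scheme.Hom.stalkMap_comp]; rfl
      rw [h2, h1, CommRingCat.hom_comp, RingHom.comp_apply, ← h4]
      exact congrArg _ h3
    have hcoef' : ∀ a : X'.presheaf.stalk (j (υ y)),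
        χ' (algebraMap _ _ ((j.stalkMap (υ y)).hom a)) = (υ.stalkMap y).hom ((j.stalkMap (υ y)).hom a) :=
      fun a => hχ' _
    -- `a_l = q_l * t = q'_l * t'`
    have hqt : ∀ l, q l * t = (υ.stalkMap y).hom ((j.stalkMap (υ y)).hom (c l)) := by
      intro l
      rw [hq, ht, ← map_mul, mul_comm, blowupAlgebra.algebraMap_mul_gen, hcoef]
    have hqt' : ∀ l, q' l * t' = (υ.stalkMap y).hom ((j.stalkMap (υ y)).hom (c l)) := by
      intro l
      rw [hq', ht', ← map_mul, mul_comm, blowupAlgebra.algebraMap_mul_gen, hcoef']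
    -- `(t) = (t') = E₂_y`, so `t = u * t'` with `u` a unit
    have hspan : Ideal.span {t} = Ideal.span {t'} := by
      have h1 : stalkIdeal ((vanishingIdeal ⟨Z, hZ⟩ : F₁.IdealSheafData).comap υ) y = Ideal.span {t} := by
        rw [← hE, stalkIdeal_comap_eq_map_stalkMap, hEu, Ideal.map_span, Set.image_singleton]
        rfl
      rw [← h1, hEd]
    obtain ⟨u, hu⟩ : Associated t' t := (Ideal.span_singleton_eq_span_singleton.mp hspan).symm
    -- `t' ≠ 0`: a member of the quasi-regular `cb`, transported by the injective `υ^♯_y`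
    have ht'0 : t' ≠ 0 := by
      rw [ht', hχ']
      intro h0
      have h1 : cb j' = 0 := hυ.stalkMap_injective y (h0.trans (map_zero _).symm)
      exact ne_zero_of_isQuasiRegular hcbar hcbtop j' h1
    -- `q' = u • q`
    have hqq : q' = (u : F₂.presheaf.stalk y) • q := by
      funext l
      have h1 : q' l * t' = ((u : F₂.presheaf.stalk y) * q l) * t' := by
        rw [hqt', ← hqt l, ← hu]; ring
      simp only [Pi.smul_apply, smul_eq_mul]
      exact mul_right_cancel₀ ht'0 h1
    -- the two forms, evaluated
    set P : MvPolynomial (Fin r) (F₂.presheaf.stalk y) :=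
      MvPolynomial.map ((υ.stalkMap y).hom.comp (j.stalkMap (υ y)).hom) Φ with hP
    have hPd : P.IsHomogeneous d := hΦd.map _
    have hψalg : ψ.comp (algebraMap _ (blowupAlgebra (Ideal.span (Set.range c)) (c jj))) =
        (υ.stalkMap y).hom.comp (j.stalkMap (υ y)).hom := RingHom.ext fun a => hcoef a
    have hχ'alg : (χ'.comp (algebraMap _ (blowupAlgebra (Ideal.span (Set.range cb)) (cb j')))).comp
        (j.stalkMap (υ y)).hom = (υ.stalkMap y).hom.comp (j.stalkMap (υ y)).hom := RingHom.ext fun a => hcoef' a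
    have hup : ψ (MvPolynomial.aeval (blowupAlgebra.frac c jj) Φ) = MvPolynomial.eval q P := by
      rw [MvPolynomial.aeval_def, MvPolynomial.eval₂_comp_left, hψalg, hP, MvPolynomial.eval_map]
      rfl
    have hdown : χ' (MvPolynomial.aeval (blowupAlgebra.frac cb j') Φb) =
        (u : F₂.presheaf.stalk y) ^ d * MvPolynomial.eval q P := by
      rw [MvPolynomial.aeval_def, MvPolynomial.eval₂_comp_left, hΦb, MvPolynomial.eval₂_map, hχ'alg,
        ← MvPolynomial.eval_map, ← hP, ← eval_smul_of_isHomogeneous' hPd, ← hqq]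
      rfl
    -- conclude at `y`
    rw [stalkIdeal_comap_eq_map_stalkMap, hStu, Ideal.map_span, Set.image_singleton, hStd]
    change Ideal.span {ψ _} = Ideal.span {χ' _}
    rw [hup, hdown, Ideal.span_singleton_mul_left_unit (u.isUnit.pow d)]
  · -- off the exceptional locus both sides are the total transform `(K · 𝒪_{F₁}) · 𝒪_{F₂} = (K · 𝒪_{X₁}) · 𝒪_{F₂}`
    have hyE : y ∉ ((vanishingIdeal ⟨Z, hZ⟩ : F₁.IdealSheafData).comap υ).support := by
      intro h
      have h' : y ∈ (((vanishingIdeal ⟨Z, hZ⟩ : F₁.IdealSheafData).comap υ).support : Set F₂) := h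
      rw [Scheme.IdealSheafData.support_comap, TopologicalSpace.Closeds.coe_preimage,
        Scheme.IdealSheafData.coe_support_vanishingIdeal] at h'
      exact hy h'
    have hyE' : j₂ y ∉ (J.comap τ).support := by
      intro h
      apply hyE
      have h' : y ∈ (((J.comap τ).comap j₂).support : Set F₂) := by
        rw [Scheme.IdealSheafData.support_comap]
        exact h
      rw [hE] at h'
      exact h'
    have hR : stalkIdeal (strictTransformIdeal υ (vanishingIdeal ⟨Z, hZ⟩) (K.comap j)) y =
        stalkIdeal ((K.comap j).comap υ) y := by
      rw [stalkIdeal_strictTransformIdeal_of_not_mem _ _ (K.comap j) hyE, ← stalkIdeal_comap_eq_map_stalkMap]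
    have hL : stalkIdeal ((strictTransformIdeal τ J K).comap j₂) y = stalkIdeal ((K.comap τ).comap j₂) y := by
      rw [stalkIdeal_comap_eq_map_stalkMap, stalkIdeal_strictTransformIdeal_of_not_mem _ _ K hyE',
        ← stalkIdeal_comap_eq_map_stalkMap, ← stalkIdeal_comap_eq_map_stalkMap]
    rw [hL, hR, ← Scheme.IdealSheafData.comap_comp, ← Scheme.IdealSheafData.comap_comp, hcomm]


section PreLetterCurveRound

variable (O : Type) [CommRing O] [IsDomain O] [IsDiscreteValuationRing O]

/-- **(Δ2b) AN IMMATURE HYPERSURFACE (pre-letter) THROUGH A CURVE ROUND** (WIDTH TABLE D5, engine row D5-2; sub-clause (ii-T) of D5-0b v1).  At a stage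
`(X, σ)` over `q` with special fibre `jG : G → X`, let the round's centre be an ideal sheaf `𝒞` — regular, with trace `𝒞·𝒪_G = 𝓘⟨Z⟩`, 2-frames at its support (a relative
CURVE; ✓ `hFrame_of_ringKrullDim_redSub`) — and `τ = Bl_𝒞`, `υ₂ = Bl_Z` with `j₂ ≫ τ = υ₂ ≫ jG`; downstairs `Z̃` regular, `G` regular at the closed points of `Z` and of
codimension `2` there (the curve clause).  For a hypersurface `𝓜` — principal, `O`-flat, `≠ ⊥`, off `Y`, reduced trace `𝓘⟨M⟩`, NOT assumed regular — of order `≥ a` along `𝒞`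
at the closed points of `Z` (`𝓜_{j z} ≤ 𝒞_{j z}^a`) and GENERICALLY EQUIMULTIPLE of order `a` along `Z` downstairs (`(𝓜·𝒪_G)_z ⊄ 𝓘⟨Z⟩_z^{a+1}` at every closed `z ∈ Z` — a
statement in the DOMAIN `𝒪_{Z̃,z}`, tolerant of jump points), the four pre-letter clauses PERSIST for `St_τ 𝓜` and its trace is `𝓘⟨closure (υ₂⁻¹(M ∖ Z))⟩`.  Trace = F⁺5 along a
curve (`comap_strictTransformIdeal_eq_of_curveModel`) with the cone packs assembled from the frames (`Ideal.mem_span_pow_iff_exists_isHomogeneous`,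
`eval_mem_pow_succ_of_map_mk_eq_zero`, `isQuasiRegular_of_span_pair_eq_stalkIdeal`, `isRegularLocalRing_quotient_stalkIdeal_of_isRegular_subscheme`).
[cite: GortzWedhorn2020, Prop. 13.91] [cite: Matsumura1987, Thm. 14.2 with Thm. 16.2] [OURS · L1 W4.5b · WIDTH TABLE D5 brick Δ2b] -/
theorem preLetterClauses_strictTransform_of_curveRound {P X X₂ G G₂ : Scheme.{0}} (σ : X ⟶ P) (Y : Set P) (q : P ⟶ Spec (.of O))
    [IsLocallyNoetherian X] [IsIntegral X] [IsLocallyNoetherian X₂] [IsLocallyNoetherian G] [IsIntegral G] [IsLocallyNoetherian G₂] [IsIntegral G₂]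
    [JacobsonSpace G₂] (hX : Scheme.IsRegular X) (jG : G ⟶ X)
    -- the centre: a relative curve with 2-frames, its trace, the round and the new model square
    (𝒞 : X.IdealSheafData) {Z : Set G} (hZ : IsClosed Z) (hCtr : 𝒞.comap jG = vanishingIdeal ⟨Z, hZ⟩) (hCreg : Scheme.IsRegular 𝒞.subscheme) (hC0 : 𝒞 ≠ ⊥)
    (hfr : ∀ x ∈ 𝒞.support, ∃ c : Fin 2 → X.presheaf.stalk x, Ideal.span (Set.range c) = stalkIdeal 𝒞 x ∧ IsQuasiRegular c)
    {τ : X₂ ⟶ X} (hτ : IsBlowup τ 𝒞) {υ₂ : G₂ ⟶ G} (hυ₂ : IsBlowup υ₂ (vanishingIdeal ⟨Z, hZ⟩)) (j₂ : G₂ ⟶ X₂) (hcomm : j₂ ≫ τ = υ₂ ≫ jG)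
    -- downstairs: `Z̃` regular, `G` regular of codimension 2 along `Z` at closed points
    (hZreg : Scheme.IsRegular (vanishingIdeal (⟨Z, hZ⟩ : Closeds G)).subscheme)
    (hGreg : ∀ z ∈ Z, IsClosed ({z} : Set G) → IsRegularLocalRing (G.presheaf.stalk z))
    (hcodim : ∀ z ∈ Z, IsClosed ({z} : Set G) →
      ringKrullDim (G.presheaf.stalk z ⧸ stalkIdeal (vanishingIdeal (⟨Z, hZ⟩ : Closeds G)) z) + 2 = ringKrullDim (G.presheaf.stalk z))
    -- the pre-letter and its four clauses
    (𝓜 : X.IdealSheafData) (h𝓜0 : 𝓜 ≠ ⊥) (h𝓜pr : ∀ z : X, (stalkIdeal 𝓜 z).IsPrincipal) (h𝓜fl : Flat (𝓜.subschemeι ≫ σ ≫ q))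
    (h𝓜off : σ '' (𝓜.support : Set X) ⊆ {p : P | ¬ IsGenericPoint p Y})
    (M : Set G) (hM : IsClosed M) (h𝓜tr : 𝓜.comap jG = vanishingIdeal ⟨M, hM⟩)
    -- the equimultiplicity datum of order `a` along the centre
    (a : ℕ) (hord : ∀ z ∈ Z, IsClosed ({z} : Set G) → stalkIdeal 𝓜 (jG z) ≤ stalkIdeal 𝒞 (jG z) ^ a)
    (hgen : ∀ z ∈ Z, IsClosed ({z} : Set G) →
      ¬ stalkIdeal (𝓜.comap jG) z ≤ stalkIdeal (vanishingIdeal (⟨Z, hZ⟩ : Closeds G)) z ^ (a + 1)) :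
    (∀ z : X₂, (stalkIdeal (strictTransformIdeal τ 𝒞 𝓜) z).IsPrincipal) ∧
    Flat ((strictTransformIdeal τ 𝒞 𝓜).subschemeι ≫ (τ ≫ σ) ≫ q) ∧
    strictTransformIdeal τ 𝒞 𝓜 ≠ ⊥ ∧
    (τ ≫ σ) '' ((strictTransformIdeal τ 𝒞 𝓜).support : Set X₂) ⊆ {p : P | ¬ IsGenericPoint p Y} ∧
    (strictTransformIdeal τ 𝒞 𝓜).comap j₂ = vanishingIdeal ⟨closure (υ₂ ⁻¹' (M \ Z)), isClosed_closure⟩ := by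
  classical
  refine ⟨fun z => isPrincipal_stalkIdeal_strictTransformIdeal hX hCreg hτ hC0 𝓜 h𝓜pr z,
    flat_strictTransform_subschemeι_comp_stage O σ q τ 𝒞 hτ 𝓜 h𝓜fl, strictTransformIdeal_ne_bot hτ hC0 h𝓜0, ?_, ?_⟩
  · rintro _ ⟨z, hz, rfl⟩
    have hz' : τ z ∈ (𝓜.support : Set X) := apply_mem_support_of_mem_support_strictTransformIdeal 𝓜 hz
    exact h𝓜off ⟨τ z, hz', (Scheme.Hom.comp_apply τ σ z).symm⟩
  -- the cone packs at the closed points of `Z`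
  have hpack : ∀ z ∈ Z, IsClosed ({z} : Set G) → ∃ (r : ℕ) (c : Fin r → X.presheaf.stalk (jG z)) (d : ℕ)
      (Φ : MvPolynomial (Fin r) (X.presheaf.stalk (jG z))),
      Ideal.span (Set.range c) = stalkIdeal 𝒞 (jG z) ∧ IsQuasiRegular c ∧ IsDomain (X.presheaf.stalk (jG z) ⧸ Ideal.span (Set.range c)) ∧
      Φ.IsHomogeneous d ∧ MvPolynomial.map (Ideal.Quotient.mk (Ideal.span (Set.range c))) Φ ≠ 0 ∧
      stalkIdeal 𝓜 (jG z) = Ideal.span {MvPolynomial.eval c Φ} ∧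
      IsQuasiRegular (fun i => (jG.stalkMap z).hom (c i)) ∧
      IsDomain (G.presheaf.stalk z ⧸ stalkIdeal (vanishingIdeal ⟨Z, hZ⟩ : G.IdealSheafData) z) ∧
      MvPolynomial.map (Ideal.Quotient.mk (Ideal.span (Set.range fun i => (jG.stalkMap z).hom (c i))))
        (MvPolynomial.map (jG.stalkMap z).hom Φ) ≠ 0 := by
    intro z hz hzcl
    -- the point lies on the centre upstairs and on `Z̃` downstairs
    have hzsupp : z ∈ ((vanishingIdeal (⟨Z, hZ⟩ : Closeds G) : G.IdealSheafData).support : Set G) := by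
      rw [Scheme.IdealSheafData.coe_support_vanishingIdeal]; exact hz
    have hmem : jG z ∈ (𝒞.support : Set X) := by
      have h : z ∈ ((𝒞.comap jG).support : Set G) := by rw [hCtr]; exact hzsupp
      rw [Scheme.IdealSheafData.support_comap] at h
      exact h
    -- the frame and the domain upstairs
    obtain ⟨c, hc1, hc2⟩ := hfr _ hmem
    have hregU : IsRegularLocalRing (X.presheaf.stalk (jG z) ⧸ stalkIdeal 𝒞 (jG z)) :=
      isRegularLocalRing_quotient_stalkIdeal_of_isRegular_subscheme 𝒞 hCreg hmem
    have hdomU : IsDomain (X.presheaf.stalk (jG z) ⧸ Ideal.span (Set.range c)) := by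
      rw [hc1]; exact isDomain_of_isRegularLocalRing _
    -- the downstairs frame generates `𝓘⟨Z⟩_z`
    set cb : Fin 2 → G.presheaf.stalk z := fun i => (jG.stalkMap z).hom (c i) with hcb
    have hcbJ : Ideal.span (Set.range cb) = stalkIdeal (vanishingIdeal ⟨Z, hZ⟩ : G.IdealSheafData) z := by
      rw [← hCtr, stalkIdeal_comap_eq_map_stalkMap, ← hc1, Ideal.map_span, hcb, ← Set.range_comp]
      rfl
    -- the domain downstairs and the quasi-regularity of the downstairs frame (codimension two)
    have hregD : IsRegularLocalRing (G.presheaf.stalk z ⧸ stalkIdeal (vanishingIdeal (⟨Z, hZ⟩ : Closeds G)) z) :=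
      isRegularLocalRing_quotient_stalkIdeal_of_isRegular_subscheme _ hZreg hzsupp
    have hdomD : IsDomain (G.presheaf.stalk z ⧸ stalkIdeal (vanishingIdeal ⟨Z, hZ⟩ : G.IdealSheafData) z) := isDomain_of_isRegularLocalRing _
    obtain ⟨s, hs⟩ : z ∈ Set.range (vanishingIdeal (⟨Z, hZ⟩ : Closeds G)).subschemeι := by
      rw [Scheme.IdealSheafData.range_subschemeι]; exact hzsupp
    subst hs
    haveI := hGreg _ hz hzcl
    have hcbar : IsQuasiRegular cb :=
      isQuasiRegular_of_span_pair_eq_stalkIdeal (vanishingIdeal (⟨Z, hZ⟩ : Closeds G)) hZreg s (hcodim _ hz hzcl) cb hcbJ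
    -- the equation of `𝓜` as a form of degree `a` in the frame
    obtain ⟨Gm, hGm⟩ := (h𝓜pr (jG ((vanishingIdeal (⟨Z, hZ⟩ : Closeds G)).subschemeι s))).principal
    have hGm' : stalkIdeal 𝓜 (jG ((vanishingIdeal (⟨Z, hZ⟩ : Closeds G)).subschemeι s)) = Ideal.span {Gm} := hGm
    have hGa : Gm ∈ Ideal.span (Set.range c) ^ a := by
      rw [hc1]; exact hord _ hz hzcl (hGm' ▸ Ideal.mem_span_singleton_self Gm)
    obtain ⟨Φ, hΦd, hΦev⟩ := (Ideal.mem_span_pow_iff_exists_isHomogeneous c Gm).mp hGa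
    have hK : stalkIdeal 𝓜 (jG ((vanishingIdeal (⟨Z, hZ⟩ : Closeds G)).subschemeι s)) = Ideal.span {MvPolynomial.eval c Φ} := by
      rw [hΦev]; exact hGm'
    -- generic equimultiplicity downstairs ⇒ the form is non-zero modulo the frame, downstairs and upstairs
    have hevbar : MvPolynomial.eval cb (MvPolynomial.map (jG.stalkMap _).hom Φ) = (jG.stalkMap _).hom Gm := by
      rw [← hΦev, ← MvPolynomial.eval₂_eq_eval_map]
      show MvPolynomial.eval₂ (jG.stalkMap _).hom _ Φ = (jG.stalkMap _).hom (MvPolynomial.eval₂ (RingHom.id _) c Φ)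
      rw [MvPolynomial.eval₂_comp_left (jG.stalkMap _).hom (RingHom.id _) c Φ, RingHom.comp_id]
      rfl
    have hGbar : (jG.stalkMap _).hom Gm ∉ stalkIdeal (vanishingIdeal (⟨Z, hZ⟩ : Closeds G)) _ ^ (a + 1) := by
      intro h
      apply hgen _ hz hzcl
      rw [stalkIdeal_comap_eq_map_stalkMap, hGm', Ideal.map_span, Set.image_singleton, Ideal.span_le, Set.singleton_subset_iff]
      exact h
    have hΦbar : MvPolynomial.map (Ideal.Quotient.mk (Ideal.span (Set.range cb))) (MvPolynomial.map (jG.stalkMap _).hom Φ) ≠ 0 := by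
      intro h0
      apply hGbar
      rw [← hevbar, ← hcbJ]
      exact eval_mem_pow_succ_of_map_mk_eq_zero _ (hΦd.map _) h0
    have hΦ : MvPolynomial.map (Ideal.Quotient.mk (Ideal.span (Set.range c))) Φ ≠ 0 := by
      intro h0
      apply hGbar
      have h1 : Gm ∈ Ideal.span (Set.range c) ^ (a + 1) := hΦev ▸ eval_mem_pow_succ_of_map_mk_eq_zero c hΦd h0
      have h2 : (jG.stalkMap _).hom Gm ∈ (Ideal.span (Set.range c) ^ (a + 1)).map (jG.stalkMap _).hom := Ideal.mem_map_of_mem _ h1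
      rw [Ideal.map_pow, Ideal.map_span, ← Set.range_comp] at h2
      rw [← hcbJ]
      exact h2
    exact ⟨2, c, a, Φ, hc1, hc2, hdomU, hΦd, hΦ, hK, hcbar, hdomD, hΦbar⟩
  rw [comap_strictTransformIdeal_eq_of_curveModel τ 𝒞 𝓜 hτ jG υ₂ j₂ hcomm Z hZ hυ₂ hCtr hpack, h𝓜tr,
    strictTransformIdeal_vanishingIdeal_eq υ₂ _ hυ₂ M hM]
  congr 1

end PreLetterCurveRound

end Summit.ResolutionOfSingularities.ResolutionOfSingularities.Cruxes.EquisingularLiftNat.Sections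

end
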